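import Summits.QuantumFields.YangMills.Theorems.LangevinControlUVFemtoCurvatureTwoPointStrictRPOddStrict
import Literature.MathematicalPhysics.QuantumFieldTheory.YangMillsOS

/-!
# Crux `FemtoCurvatureTwoPoint` (stmt-QuantumFields-9363, route `LangevinControlUV`):
# strict positivity of the axis covariance — the registered sub-goal `stub_axisPositive`

`--supports stmt-QuantumFields-9363`. The registered stub `stub_axisPositive` of the rate-free
skeleton of line `generic-step-gamma-encoding` (lead c3, reshape 4): for every compact simple Lie
group `G`, every faithful continuous unitary lattice representation `r`, every torus side `L ≥ 8`,
eventually in `β`: `Cov_{L,β}(P_0^{01}, P_{e₂}^{01}) > 0`. Proved in the strong form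
`StrictRP.cruxAxisCov_one_pos`: for EVERY `β > 0`, every `L ≥ 4` (even: `…SiteStrict`; odd:
`cruxAxisCov_one_pos_of_odd`, the odd-mirror pair of the middle slice transported to the crux's pair
at separation `2` by `timeReflect_single`, `cov_symm`, `cov_translate`, `cruxAxisCov_eq`, then lowered to
separation `1` by the landed antitone axis profile), every compact `G ≠ 1` and every continuous
faithful unitary `ρ`; compact simple Lie groups are non-abelian, hence non-trivial. This is the strict
form of Osterwalder–Seiler positivity: Wilson's transfer matrix is positive DEFINITE for a faithful
representation (Seiler, LNP 159 (1982), Ch. 2) — proved here without the character expansion, by a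
Gram/Stone–Weierstrass injectivity argument for one transfer step.
-/

set_option autoImplicit false

noncomputable section

namespace Summit.QuantumFields.YangMills.Theorems.FemtoCurvatureTwoPoint.StrictRP

open MeasureTheory Finset
open scoped Matrix ComplexConjugate
open Literature.MathematicalPhysics.QuantumFieldTheory

section CruxOdd

variable {L N : ℕ} [NeZero L] {G : Type*} [Group G] [TopologicalSpace G] [IsTopologicalGroup G]
  [CompactSpace G] [MeasurableSpace G] [BorelSpace G] (ρ : G →* Matrix (Fin N) (Fin N) ℂ)

/-- **The crux's reference covariance at separation `2` is strictly positive (odd torus, `L ≥ 3`).**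
[folklore] -/
theorem cruxAxisCov_two_pos_of_odd (hL : Odd L) (hL3 : 3 ≤ L) (hρ : Continuous ρ)
    (hinj : Function.Injective ρ) (hunit : ∀ g, ρ g ∈ Matrix.unitaryGroup (Fin N) ℂ)
    (hG : ∃ g : G, g ≠ 1) {β : ℝ} (hβ : 0 < β) :
    0 < wilsonExpectation ρ β (fun U : GaugeConfig 4 L G =>
          ((N : ℝ) - (ρ (plaquetteHolonomy U 0 0 1)).trace.re) *
            ((N : ℝ) - (ρ (plaquetteHolonomy U
              (Pi.single (2 : Fin 4) (((2 : ℕ) : ℕ) : ZMod L)) 0 1)).trace.re))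
        - wilsonExpectation ρ β (fun U : GaugeConfig 4 L G =>
            (N : ℝ) - (ρ (plaquetteHolonomy U 0 0 1)).trace.re)
          * wilsonExpectation ρ β (fun U : GaugeConfig 4 L G =>
            (N : ℝ) - (ρ (plaquetteHolonomy U
              (Pi.single (2 : Fin 4) (((2 : ℕ) : ℕ) : ZMod L)) 0 1)).trace.re) := by
  haveI : Fact (1 < L) := ⟨by omega⟩
  rw [AxisCovNonneg.cruxAxisCov_eq ρ hρ β 2]
  set q12 : {p : Fin 4 × Fin 4 // p.1 < p.2} := ⟨((1 : Fin 4), (2 : Fin 4)), by decide⟩ with hq12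
  have hq : q12.1.1 ≠ 0 := by simp [hq12]
  have hval : ((Pi.single (0 : Fin 4) (((L / 2 : ℕ)) : ZMod L) : Site 4 L) 0).val = L / 2 := by
    rw [Pi.single_eq_same, ZMod.val_natCast, Nat.mod_eq_of_lt (by omega)]
  have h := cov_timeReflect_pair_pos_odd (d := 4) (L := L) ρ hL hL3 hρ hinj hunit hG hβ
    (q := (((Pi.single (0 : Fin 4) (((L / 2 : ℕ)) : ZMod L) : Site 4 L)), q12)) hq hval
  dsimp only at h
  rw [AxisCovNonneg.timeReflect_single, AxisCovNonneg.cov_symm,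
    AxisCovNonneg.cov_translate ρ β _ _ (Pi.single (0 : Fin 4) (((L / 2 : ℕ)) : ZMod L)) q12] at h
  obtain ⟨k, hk⟩ := hL
  have hLk : ((2 * k + 1 : ℕ) : ZMod L) = 0 := by rw [← hk]; exact ZMod.natCast_self L
  have hdiv : L / 2 = k := by omega
  have e1 : (Pi.single (0 : Fin 4) (((L / 2 : ℕ)) : ZMod L) : Site 4 L) -
      Pi.single (0 : Fin 4) (((L / 2 : ℕ)) : ZMod L) = 0 := sub_self _
  have e2 : (Pi.single (0 : Fin 4) (1 - (((L / 2 : ℕ)) : ZMod L)) : Site 4 L) -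
      Pi.single (0 : Fin 4) (((L / 2 : ℕ)) : ZMod L) = Pi.single (0 : Fin 4) (((2 : ℕ) : ℕ) : ZMod L) := by
    rw [← Pi.single_sub]
    congr 1
    rw [hdiv]
    push_cast at hLk ⊢
    linear_combination (-1 : ZMod L) * hLk
  rw [e1, e2] at h
  exact h

/-- **The crux's reference covariance at separation `1` is strictly positive (odd torus, `L ≥ 5`)**:
antitone axis profile (`k = 1 ≤ n = 2`, `4 ≤ L`). [folklore] -/
theorem cruxAxisCov_one_pos_of_odd (hL : Odd L) (hL5 : 5 ≤ L) (hρ : Continuous ρ)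
    (hinj : Function.Injective ρ) (hunit : ∀ g, ρ g ∈ Matrix.unitaryGroup (Fin N) ℂ)
    (hG : ∃ g : G, g ≠ 1) {β : ℝ} (hβ : 0 < β) :
    0 < wilsonExpectation ρ β (fun U : GaugeConfig 4 L G =>
          ((N : ℝ) - (ρ (plaquetteHolonomy U 0 0 1)).trace.re) *
            ((N : ℝ) - (ρ (plaquetteHolonomy U
              (Pi.single (2 : Fin 4) (((1 : ℕ) : ℕ) : ZMod L)) 0 1)).trace.re))
        - wilsonExpectation ρ β (fun U : GaugeConfig 4 L G =>
            (N : ℝ) - (ρ (plaquetteHolonomy U 0 0 1)).trace.re)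
          * wilsonExpectation ρ β (fun U : GaugeConfig 4 L G =>
            (N : ℝ) - (ρ (plaquetteHolonomy U
              (Pi.single (2 : Fin 4) (((1 : ℕ) : ℕ) : ZMod L)) 0 1)).trace.re) :=
  lt_of_lt_of_le (cruxAxisCov_two_pos_of_odd ρ hL (by omega) hρ hinj hunit hG hβ)
    (AxisCovNonneg.axisPlaquetteCov_antitone ρ hρ hβ.le (k := 1) (n := 2) (by norm_num) (by omega))

/-- **The crux's reference covariance at separation `1` is strictly positive on every torus `L ≥ 4`,
for every `β > 0`** (even: `cruxAxisCov_one_pos_of_even`; odd: `cruxAxisCov_one_pos_of_odd`, odd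
`L ≥ 4` means `L ≥ 5`). [folklore] -/
theorem cruxAxisCov_one_pos (hL4 : 4 ≤ L) (hρ : Continuous ρ)
    (hinj : Function.Injective ρ) (hunit : ∀ g, ρ g ∈ Matrix.unitaryGroup (Fin N) ℂ)
    (hG : ∃ g : G, g ≠ 1) {β : ℝ} (hβ : 0 < β) :
    0 < wilsonExpectation ρ β (fun U : GaugeConfig 4 L G =>
          ((N : ℝ) - (ρ (plaquetteHolonomy U 0 0 1)).trace.re) *
            ((N : ℝ) - (ρ (plaquetteHolonomy U
              (Pi.single (2 : Fin 4) (((1 : ℕ) : ℕ) : ZMod L)) 0 1)).trace.re))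
        - wilsonExpectation ρ β (fun U : GaugeConfig 4 L G =>
            (N : ℝ) - (ρ (plaquetteHolonomy U 0 0 1)).trace.re)
          * wilsonExpectation ρ β (fun U : GaugeConfig 4 L G =>
            (N : ℝ) - (ρ (plaquetteHolonomy U
              (Pi.single (2 : Fin 4) (((1 : ℕ) : ℕ) : ZMod L)) 0 1)).trace.re) := by
  rcases Nat.even_or_odd L with hL | hL
  · exact cruxAxisCov_one_pos_of_even ρ hL hL4 hρ hinj hunit hG hβ
  · exact cruxAxisCov_one_pos_of_odd ρ hL (by obtain ⟨k, hk⟩ := hL; omega) hρ hinj hunit hG hβ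

/-- **Every axis separation is strictly positive**: `Cov_{L,β}(P_0^{01}, P_{ne₂}^{01}) > 0` for all
`1 ≤ n ≤ L − 1` (`L ≥ 4`, `β > 0`, `G ≠ 1`, `ρ` continuous faithful unitary) — from separation `1` by the
landed log-convexity of the axis profile (`axisProfile_logConvex`): `f(n)² ≤ f(n−1) f(n+1)` with
`f ≥ 0` propagates strict positivity upwards. [folklore] -/
theorem cruxAxisCov_pos (hL4 : 4 ≤ L) (hρ : Continuous ρ)
    (hinj : Function.Injective ρ) (hunit : ∀ g, ρ g ∈ Matrix.unitaryGroup (Fin N) ℂ)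
    (hG : ∃ g : G, g ≠ 1) {β : ℝ} (hβ : 0 < β) {n : ℕ} (hn1 : 1 ≤ n) (hnL : n + 1 ≤ L) :
    0 < wilsonExpectation ρ β (fun U : GaugeConfig 4 L G =>
          ((N : ℝ) - (ρ (plaquetteHolonomy U 0 0 1)).trace.re) *
            ((N : ℝ) - (ρ (plaquetteHolonomy U
              (Pi.single (2 : Fin 4) ((n : ℕ) : ZMod L)) 0 1)).trace.re))
        - wilsonExpectation ρ β (fun U : GaugeConfig 4 L G =>
            (N : ℝ) - (ρ (plaquetteHolonomy U 0 0 1)).trace.re)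
          * wilsonExpectation ρ β (fun U : GaugeConfig 4 L G =>
            (N : ℝ) - (ρ (plaquetteHolonomy U
              (Pi.single (2 : Fin 4) ((n : ℕ) : ZMod L)) 0 1)).trace.re) := by
  set q12 : {p : Fin 4 × Fin 4 // p.1 < p.2} := ⟨((1 : Fin 4), (2 : Fin 4)), by decide⟩ with hq12
  have hq : q12.1.1 ≠ 0 := by simp [hq12]
  set f : ℕ → ℝ := fun s => wilsonExpectation ρ β (fun U : GaugeConfig 4 L G =>
        WilsonRP.plaqRe ρ U ((0 : Site 4 L), q12) *
          WilsonRP.plaqRe ρ U ((Pi.single (0 : Fin 4) ((s : ℕ) : ZMod L) : Site 4 L), q12))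
      - wilsonExpectation ρ β (fun U : GaugeConfig 4 L G =>
          WilsonRP.plaqRe ρ U ((0 : Site 4 L), q12))
        * wilsonExpectation ρ β (fun U : GaugeConfig 4 L G =>
          WilsonRP.plaqRe ρ U ((Pi.single (0 : Fin 4) ((s : ℕ) : ZMod L) : Site 4 L), q12)) with hf
  have hf1 : 0 < f 1 := by
    have h := cruxAxisCov_one_pos ρ hL4 hρ hinj hunit hG hβ
    rw [AxisCovNonneg.cruxAxisCov_eq ρ hρ β 1] at h
    exact h
  have hnn : ∀ s, 0 ≤ f s := fun s =>
    AxisCovNonneg.timeAxisCov_nonneg (L := L) (d := 3) ρ hρ hβ.le q12 hq s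
  have key : ∀ m : ℕ, 1 ≤ m → m + 1 ≤ L → 0 < f m := by
    intro m
    induction m with
    | zero => intro h; omega
    | succ m ih =>
      intro _ h2
      rcases Nat.eq_zero_or_pos m with rfl | hm
      · exact hf1
      · have hpos : 0 < f m := ih hm (by omega)
        have hlc := AxisCovNonneg.axisProfile_logConvex (L := L) (d := 3) ρ hρ hβ.le q12 hq f hf
          (n := m) hm (by omega)
        by_contra hle
        have hle' : f (m + 1) ≤ 0 := not_lt.1 hle
        have h1 : f (m - 1) * f (m + 1) ≤ 0 := mul_nonpos_of_nonneg_of_nonpos (hnn _) hle'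
        nlinarith [pow_pos hpos 2]
  rw [AxisCovNonneg.cruxAxisCov_eq ρ hρ β n]
  exact key n hn1 hnL

end CruxOdd

/-! ### The registered sub-goal `stub_axisPositive` -/

section Stub

/-- Compact simple Lie groups are non-trivial (they are non-abelian). [folklore] -/
theorem exists_ne_one_of_isCompactSimpleLieGroup {G : Type} [Group G] [TopologicalSpace G]
    [CompactSpace G] (hG : IsCompactSimpleLieGroup G) : ∃ g : G, g ≠ 1 := by
  obtain ⟨a, b, hab⟩ := hG.1.2.1
  by_cases ha : a = 1
  · exact absurd (by rw [ha, one_mul, mul_one]) hab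
  · exact ⟨a, ha⟩

end Stub

end Summit.QuantumFields.YangMills.Theorems.FemtoCurvatureTwoPoint.StrictRP

namespace Summit.QuantumFields.YangMills.Theorems.FemtoCurvatureTwoPoint

open Literature.MathematicalPhysics.QuantumFieldTheory

/-- **Registered sub-goal `stub_axisPositive`** of the rate-free skeleton of line
`generic-step-gamma-encoding` (lead c3, reshape 4; `--supports stmt-QuantumFields-9363`), proved in
the strong form "for EVERY coupling above any threshold" with the threshold `B := 1`: for every
compact simple Lie group `G` (tree `IsCompactSimpleLieGroup`: non-abelian, hence `G ≠ 1`), every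
faithful continuous unitary lattice representation `r` and every torus side `L ≥ 8`, the crux's
reference axis covariance `Cov_{L,β}(P_0^{01}, P_{e₂}^{01})` is strictly positive for all `β ≥ 1`
(indeed for all `β > 0`: `StrictRP.cruxAxisCov_one_pos`) — strict Osterwalder–Seiler positivity of
Wilson's transfer matrix for a faithful representation, through sites (even `L`) and through the
mixed site/link reflection (odd `L`). [folklore] -/
theorem stub_axisPositive : ∀ (G : Type) [Group G] [TopologicalSpace G] [IsTopologicalGroup G] [CompactSpace G] [MeasurableSpace G] [BorelSpace G], IsCompactSimpleLieGroup G → ∀ (r : LatticeRep G) (L : ℕ) [NeZero L], 8 ≤ L → ∃ B : ℝ, ∀ β : ℝ, B ≤ β → 0 < wilsonExpectation r.ρ β (fun U : GaugeConfig 4 L G => ((r.N : ℝ) - (r.ρ (plaquetteHolonomy U 0 0 1)).trace.re) * ((r.N : ℝ) - (r.ρ (plaquetteHolonomy U (Pi.single (2 : Fin 4) (((1 : ℕ) : ℕ) : ZMod L)) 0 1)).trace.re)) - wilsonExpectation r.ρ β (fun U : GaugeConfig 4 L G => (r.N : ℝ) - (r.ρ (plaquetteHolonomy U 0 0 1)).trace.re)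 * wilsonExpectation r.ρ β (fun U : GaugeConfig 4 L G => (r.N : ℝ) - (r.ρ (plaquetteHolonomy U (Pi.single (2 : Fin 4) (((1 : ℕ) : ℕ) : ZMod L)) 0 1)).trace.re) := by
  intro G _ _ _ _ _ _ hG r L _ hL8
  refine ⟨1, fun β hβ => ?_⟩
  have hL4 : 4 ≤ L := by omega
  exact StrictRP.cruxAxisCov_one_pos (L := L) r.ρ hL4 r.continuous r.injective r.mem_unitary
    (StrictRP.exists_ne_one_of_isCompactSimpleLieGroup hG) (lt_of_lt_of_le one_pos hβ)

end Summit.QuantumFields.YangMills.Theorems.FemtoCurvatureTwoPoint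

end
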